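import Mathlib

/-!
# Piecewise-rational functions on the real line (the coefficient module `PR_K`)

For a field `K` with an embedding `K → ℂ` (the cases of interest are `K = ℚ`, `K = ℂ`, and
intermediate fields `ℚ ⊆ K ⊆ ℂ`), a function `φ : ℝ → ℂ` is **`K`-piecewise rational**
(`IsPiecewiseRational K φ`) if there is a finite set `F ⊂ ℚ` of *breakpoints* such that on every
open interval `(a, b)` with rational end points containing no breakpoint, and on two tails
`(B, ∞)`, `(-∞, -B)` (`B ∈ ℚ`), `φ` is given by ONE fraction
`φ(x) = P(x) / Q(x)` with numerator `P ∈ K[X]`, RATIONAL denominator `Q ∈ ℚ[X]`, and `Q`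
non-vanishing on the piece (so: rational breakpoints, no real poles inside a piece, and
`K`-coefficients only in the numerator; e.g. `1/(x + √2) = (x - √2)/(x² - 2)` is admissible only on
pieces avoiding `±√2`, which is what makes `PR_ℂ` the `ℂ`-span of `PR_ℚ`). The values of `φ` AT
the finitely many breakpoints are not constrained (cocycle identities in the intended application
hold off finite sets).

This is the coefficient module `PR_K` of the route `RationalPeriodQuarter`
(`Summits/Langlands/Langlands/Theses/RationalPeriodQuarter.lean`), where the predicates
`IsPRQ` / `IsPRC` are inlined by `let`: **`IsPiecewiseRational ℚ φ` is syntactically the route's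
`IsPRQ φ`** (`isPiecewiseRational_rat_iff` is `Iff.rfl`) and `isPiecewiseRational_complex_iff`
is the route's `IsPRC φ` verbatim. The notion is the line-model (`s = 1/2`) analogue of the
rational period functions of Knopp and Choie–Zagier (`ChoieZagier1993`: rational functions `q(z)`
with poles in `ℚ ∪ {real quadratic irrationals}`, integer weight `2k`); it is route-posited, not
taken from a printed source, hence tagged folklore.

## Contents (all proved, no named facts)

* `IsRationalOn K φ S` — `φ = P/Q` on the set `S` by one fraction (`P ∈ K[X]`, `Q ∈ ℚ[X]`,
  `Q ≠ 0` on `S`); algebra of such representations (`add`, `mul`, `smul`, `inv` …),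
  **uniqueness** of the representing fraction on an infinite set (`IsRationalOn.unique`,
  `unique_rat`), **gluing** along an infinite overlap keeping the denominator rational
  (`IsRationalOn.union`, by Bézout in `ℚ[X]`: `gcd(Q₁,Q₂) = UQ₁ + VQ₂`, new numerator
  `UP₁ + VP₂`), analyticity (`IsRationalOn.analyticAt`).
* `IsPiecewiseRational K φ` and its structural form
  `IsPiecewiseRational.iff_forall_ordConnected`:
  `φ ∈ PR_K ↔ ∃ F : Finset ℚ, ∀ S ⊆ ℝ order-connected with S ∩ F = ∅, IsRationalOn K φ S`.
* `PR_K` is a `K`-subspace (indeed a `K`-subalgebra) of `ℝ → ℂ`: `piecewiseRational K :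
  Submodule K (ℝ → ℂ)`, `IsPiecewiseRational.add/smul/neg/sub/mul`; base change
  `PR_ℚ ⊆ PR_K ⊆ PR_ℂ` (`of_rat`, `to_complex`); changing values at finitely many rational points
  (`congr_off_finset`); gluing at a rational point (`piecewise_Iio`).
* Semi-analyticity: `IsPiecewiseRational.analyticAt`, `.semiAnalytic`
  (`∃ F : Finset ℝ, AnalyticOnNhd ℝ φ (↑F)ᶜ`, the route's `IsSemiAnalytic`).
* The determinant-free weight-one line-model action
  `slashHalf g φ t = |ct+d|⁻¹ φ((at+b)/(ct+d))` of an integer matrix `g = (a b; c d)`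
  (Bruggeman–Lewis–Zagier, line model (2.1) `φ|_{2s} g (x) = |cx+d|^{-2s} φ(gx)` at `2s = 1`;
  the route's `slashHalf`), its linearity, `slashHalf_one`, the cocycle law
  `slashHalf_mul_apply : φ|(gh) = (φ|g)|h` off the pole of `h`, and the main API fact
  **`IsPiecewiseRational.slashHalf`: `PR_K` is stable under `slashHalf g` for every integer
  matrix `g` with `det g ≠ 0`** (so under `SL₂(ℤ)`, `IsPiecewiseRational.slashHalf_sl`, and under
  the Hecke matrices `(1 b; 0 p)`, `(p 0; 0 1)`). Mechanism: on an order-connected set avoiding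
  the (rational) pole `-d/c` and the preimages of the breakpoints, `ct+d` has constant sign, the
  Möbius map is a `ℚ`-fraction with order-connected image avoiding `F`, and
  `P((at+b)/(ct+d))`, `1/Q((at+b)/(ct+d))` are again fractions with rational denominators.

## Design notes

* `K` is a type with `[Field K] [Algebra K ℂ]` (then `CharZero K` holds, `RingHom.charZero`);
  numerators are `P : K[X]` evaluated through `Polynomial.aeval (x : ℂ)`, denominators
  `Q : ℚ[X]`. For `K = ℚ` this is literally the route's text; for `K = ℂ`,
  `aeval x P = eval x P` (`Polynomial.coe_aeval_eq_eval`).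
* `slashHalf g φ (-d/c) = 0` (Lean's `x/0 = 0`, `|0|⁻¹ = 0`): a junk value at ONE rational point,
  harmless for `IsPiecewiseRational` (rational points may be breakpoints) and excluded by
  hypothesis in `slashHalf_mul_apply`.
* `det g ≠ 0` is needed in `IsPiecewiseRational.slashHalf`: for a degenerate `g` the function
  `t ↦ |ct+d|⁻¹ φ(const)` has the unconstrained complex number `φ(const)` as coefficient.

## Not here

The tensor-product statement `PR_ℂ = PR_ℚ ⊗_ℚ ℂ` and the coefficient-wise projection
`Π : PR_ℂ → PR_ℚ` attached to a `ℚ`-linear `π : ℂ → ℚ` (route Assembly, step (2)); parabolic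
refinements; any statement about Maass forms or cocycles (those are route items).

## References

* [BruggemanLewisZagier2015] R. Bruggeman, J. Lewis, D. Zagier, *Period functions for Maass wave
  forms and cohomology*, Mem. AMS 237 (2015), no. 1118, doi:10.1090/memo/1118 — §2.1, line model,
  eq. (2.1) (PDF pp. 11–12 of the held copy `paper:doi-10-1090-memo-1118`).
* [ChoieZagier1993] Y. Choie, D. Zagier, *Rational period functions for PSL(2,ℤ)*, Contemp. Math.
  143 (1993), 89–108, doi:10.1090/conm/143/00992 (integer-weight precedent).
-/

noncomputable section

open Polynomial Set Filter
open scoped Topology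

namespace Literature.NumberTheory.Automorphic

section Defs

variable (K : Type*) [Field K] [Algebra K ℂ]

/-- `IsRationalOn K φ S`: on the set `S ⊆ ℝ` the function `φ : ℝ → ℂ` is given by ONE fraction
`P/Q` with numerator `P ∈ K[X]`, RATIONAL denominator `Q ∈ ℚ[X]`, and `Q` non-vanishing on `S`:
`∀ x ∈ S, Q(x) ≠ 0 ∧ φ x = P(x)/Q(x)` (all evaluations in `ℂ`, through `K → ℂ`, `ℚ → ℂ` and
`ℝ → ℂ`). Auxiliary notion for `IsPiecewiseRational` (one "piece"). [folklore] -/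
def IsRationalOn (φ : ℝ → ℂ) (S : Set ℝ) : Prop :=
  ∃ (P : K[X]) (Q : ℚ[X]), ∀ x ∈ S, aeval (x : ℂ) Q ≠ 0 ∧ φ x = aeval (x : ℂ) P / aeval (x : ℂ) Q

/-- **`K`-piecewise-rational functions on the line** (the coefficient module `PR_K` of route
`RationalPeriodQuarter`; `PR_ℚ`: rational breakpoints and rational coefficients, `PR_ℂ`: complex
numerators, rational denominators). `φ : ℝ → ℂ` is `K`-piecewise rational if there is a finite set
`F ⊂ ℚ` of breakpoints such that

* on every open interval `(a, b)`, `a < b` rational, containing no point of `F`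
  (`∀ r ∈ F, r ≤ a ∨ b ≤ r`), `φ(x) = P(x)/Q(x)` for ONE pair `P ∈ K[X]`, `Q ∈ ℚ[X]` with
  `Q(x) ≠ 0` on `(a, b)`, and
* the same holds on two tails `(B, ∞)` and `(-∞, -B)` for some rational `B`.

Written with curried quantifiers so that `IsPiecewiseRational ℚ φ` is *syntactically* the
route's inlined `IsPRQ φ` (`isPiecewiseRational_rat_iff`), and `IsPiecewiseRational ℂ φ` is its
`IsPRC φ` up to `aeval = eval` (`isPiecewiseRational_complex_iff`). Equivalent structural form:
`IsPiecewiseRational.iff_forall_ordConnected`. Values at the breakpoints are unconstrained.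
Line-model analogue (weight one, `s = 1/2`) of Knopp's / Choie–Zagier's rational period
functions (cf. `ChoieZagier1993`). [folklore] -/
def IsPiecewiseRational (φ : ℝ → ℂ) : Prop :=
  ∃ F : Finset ℚ,
    (∀ a b : ℚ, a < b → (∀ r ∈ F, r ≤ a ∨ b ≤ r) →
      ∃ (P : K[X]) (Q : ℚ[X]), ∀ x : ℝ, (a : ℝ) < x → x < b →
        aeval (x : ℂ) Q ≠ 0 ∧ φ x = aeval (x : ℂ) P / aeval (x : ℂ) Q) ∧
    ∃ B : ℚ,
      (∃ (P : K[X]) (Q : ℚ[X]), ∀ x : ℝ, (B : ℝ) < x →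
        aeval (x : ℂ) Q ≠ 0 ∧ φ x = aeval (x : ℂ) P / aeval (x : ℂ) Q) ∧
      (∃ (P : K[X]) (Q : ℚ[X]), ∀ x : ℝ, x < -(B : ℝ) →
        aeval (x : ℂ) Q ≠ 0 ∧ φ x = aeval (x : ℂ) P / aeval (x : ℂ) Q)

end Defs

variable {K : Type*} [Field K] [Algebra K ℂ]

/-! ## 1. One piece: the algebra of fractions with rational denominators -/

namespace IsRationalOn

variable {φ ψ : ℝ → ℂ} {S T : Set ℝ}

/-- Compatibility of the evaluations `ℚ[X] → K[X] → ℂ` and `ℚ[X] → ℂ` (any two ring maps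
`ℚ → ℂ` agree). [folklore] -/
theorem aeval_map_algebraMap_rat [CharZero K] (Q : ℚ[X]) (x : ℂ) :
    aeval x (Q.map (algebraMap ℚ K)) = aeval x Q := by
  rw [aeval_def, eval₂_map, aeval_def,
    Subsingleton.elim ((algebraMap K ℂ).comp (algebraMap ℚ K)) (algebraMap ℚ ℂ)]

/-- Restriction to a subset. [folklore] -/
theorem mono (h : IsRationalOn K φ S) (hTS : T ⊆ S) : IsRationalOn K φ T := by
  obtain ⟨P, Q, hPQ⟩ := h
  exact ⟨P, Q, fun x hx => hPQ x (hTS hx)⟩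

/-- Only the values on `S` matter. [folklore] -/
theorem congr (h : IsRationalOn K φ S) (hφψ : ∀ x ∈ S, φ x = ψ x) : IsRationalOn K ψ S := by
  obtain ⟨P, Q, hPQ⟩ := h
  exact ⟨P, Q, fun x hx => ⟨(hPQ x hx).1, (hφψ x hx) ▸ (hPQ x hx).2⟩⟩

/-- Constants from `K`: `k = C k / 1`. [folklore] -/
theorem const (k : K) : IsRationalOn K (fun _ => algebraMap K ℂ k) S :=
  ⟨C k, 1, fun x _ => by simp⟩

/-- `0 = 0 / 1`. [folklore] -/
theorem zero : IsRationalOn K (0 : ℝ → ℂ) S :=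
  ⟨0, 1, fun x _ => by simp⟩

/-- Base change of the numerator along `ℚ → K` (`PR_ℚ ⊆ PR_K` on one piece). [folklore] -/
theorem of_rat (h : IsRationalOn ℚ φ S) : IsRationalOn K φ S := by
  haveI : CharZero K := (algebraMap K ℂ).charZero
  obtain ⟨P, Q, hPQ⟩ := h
  refine ⟨P.map (algebraMap ℚ K), Q, fun x hx => ⟨(hPQ x hx).1, ?_⟩⟩
  rw [aeval_map_algebraMap_rat]
  exact (hPQ x hx).2

/-- Base change of the numerator along `K → ℂ` (`PR_K ⊆ PR_ℂ` on one piece). [folklore] -/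
theorem to_complex (h : IsRationalOn K φ S) : IsRationalOn ℂ φ S := by
  obtain ⟨P, Q, hPQ⟩ := h
  refine ⟨P.map (algebraMap K ℂ), Q, fun x hx => ⟨(hPQ x hx).1, ?_⟩⟩
  rw [aeval_map_algebraMap]
  exact (hPQ x hx).2

/-- Sums: `P₁/Q₁ + P₂/Q₂ = (P₁Q₂ + Q₁P₂)/(Q₁Q₂)`, the denominator stays rational. [folklore] -/
theorem add (hφ : IsRationalOn K φ S) (hψ : IsRationalOn K ψ S) : IsRationalOn K (φ + ψ) S := by
  haveI : CharZero K := (algebraMap K ℂ).charZero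
  obtain ⟨P₁, Q₁, h₁⟩ := hφ
  obtain ⟨P₂, Q₂, h₂⟩ := hψ
  refine ⟨P₁ * Q₂.map (algebraMap ℚ K) + Q₁.map (algebraMap ℚ K) * P₂, Q₁ * Q₂, fun x hx => ?_⟩
  obtain ⟨hQ₁, e₁⟩ := h₁ x hx
  obtain ⟨hQ₂, e₂⟩ := h₂ x hx
  refine ⟨by rw [map_mul]; exact mul_ne_zero hQ₁ hQ₂, ?_⟩
  rw [Pi.add_apply, e₁, e₂, div_add_div _ _ hQ₁ hQ₂]
  simp only [map_add, map_mul, aeval_map_algebraMap_rat]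

/-- Negation. [folklore] -/
theorem neg (hφ : IsRationalOn K φ S) : IsRationalOn K (-φ) S := by
  obtain ⟨P, Q, h⟩ := hφ
  refine ⟨-P, Q, fun x hx => ⟨(h x hx).1, ?_⟩⟩
  rw [Pi.neg_apply, (h x hx).2, map_neg, neg_div]

/-- Differences. [folklore] -/
theorem sub (hφ : IsRationalOn K φ S) (hψ : IsRationalOn K ψ S) : IsRationalOn K (φ - ψ) S := by
  rw [sub_eq_add_neg]; exact hφ.add hψ.neg

/-- Scalars from `K` (acting on `ℝ → ℂ` through `K → ℂ`). [folklore] -/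
theorem smul (k : K) (hφ : IsRationalOn K φ S) : IsRationalOn K (k • φ) S := by
  obtain ⟨P, Q, h⟩ := hφ
  refine ⟨C k * P, Q, fun x hx => ⟨(h x hx).1, ?_⟩⟩
  rw [Pi.smul_apply, (h x hx).2, map_mul, aeval_C, Algebra.smul_def, mul_div_assoc]

/-- Products: `(P₁/Q₁)(P₂/Q₂) = P₁P₂/(Q₁Q₂)`. [folklore] -/
theorem mul (hφ : IsRationalOn K φ S) (hψ : IsRationalOn K ψ S) : IsRationalOn K (φ * ψ) S := by
  obtain ⟨P₁, Q₁, h₁⟩ := hφ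
  obtain ⟨P₂, Q₂, h₂⟩ := hψ
  refine ⟨P₁ * P₂, Q₁ * Q₂, fun x hx => ?_⟩
  obtain ⟨hQ₁, e₁⟩ := h₁ x hx
  obtain ⟨hQ₂, e₂⟩ := h₂ x hx
  refine ⟨by rw [map_mul]; exact mul_ne_zero hQ₁ hQ₂, ?_⟩
  rw [Pi.mul_apply, e₁, e₂, map_mul, map_mul, div_mul_div_comm]

/-- Inversion of a non-vanishing `ℚ`-fraction (numerator and denominator swap, so this needs
`K = ℚ`). [folklore] -/
theorem inv {φ : ℝ → ℂ} (hφ : IsRationalOn ℚ φ S) (h0 : ∀ x ∈ S, φ x ≠ 0) :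
    IsRationalOn ℚ φ⁻¹ S := by
  obtain ⟨P, Q, h⟩ := hφ
  refine ⟨Q, P, fun x hx => ?_⟩
  obtain ⟨hQ, e⟩ := h x hx
  have hP : aeval (x : ℂ) P ≠ 0 := by
    intro hP
    exact h0 x hx (by rw [e, hP, zero_div])
  exact ⟨hP, by rw [Pi.inv_apply, e, inv_div]⟩

/-- The Möbius map `t ↦ (at+b)/(ct+d)` of an integer matrix, as a `ℚ`-fraction on any set where
`ct + d ≠ 0`. [folklore] -/
theorem linFrac (a b c d : ℤ) (hS : ∀ t ∈ S, (c : ℝ) * t + d ≠ 0) :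
    IsRationalOn ℚ (fun t : ℝ => ((((a : ℝ) * t + b) / ((c : ℝ) * t + d) : ℝ) : ℂ)) S := by
  refine ⟨C (a : ℚ) * X + C (b : ℚ), C (c : ℚ) * X + C (d : ℚ), fun t ht => ?_⟩
  have hct : ((c : ℝ) : ℂ) * (t : ℂ) + ((d : ℝ) : ℂ) ≠ 0 := by
    have := hS t ht
    exact_mod_cast this
  have e1 : aeval (t : ℂ) (C (c : ℚ) * X + C (d : ℚ)) = ((c : ℝ) : ℂ) * (t : ℂ) + ((d : ℝ) : ℂ) := by
    simp
  have e2 : aeval (t : ℂ) (C (a : ℚ) * X + C (b : ℚ)) = ((a : ℝ) : ℂ) * (t : ℂ) + ((b : ℝ) : ℂ) := by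
    simp
  refine ⟨by rwa [e1], ?_⟩
  rw [e1, e2]
  push_cast
  rfl

/-- Substituting a `ℚ`-fraction `u` into a polynomial `P ∈ K[X]` gives a fraction with rational
denominator: `t ↦ P(u(t))` is `IsRationalOn K` wherever `t ↦ u(t)` is `IsRationalOn ℚ`
(induction on `P`). [folklore] -/
theorem aeval_comp {u : ℝ → ℝ} (hu : IsRationalOn ℚ (fun t => ((u t : ℝ) : ℂ)) S) (P : K[X]) :
    IsRationalOn K (fun t => aeval ((u t : ℝ) : ℂ) P) S := by
  haveI : CharZero K := (algebraMap K ℂ).charZero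
  refine P.induction_on ?_ ?_ ?_
  · intro k
    simpa using (const k : IsRationalOn K _ S)
  · intro p q hp hq
    exact (hp.add hq).congr fun x _ => by simp only [Pi.add_apply, map_add]
  · intro n k ih
    refine (ih.mul (hu.of_rat (K := K))).congr ?_
    intro x _
    simp only [Pi.mul_apply, map_mul, map_pow, aeval_X, aeval_C, pow_succ, mul_assoc]

/-- **Uniqueness of the representing fraction.** If `P₁/Q₁` and `P₂/Q₂` both represent `φ` on an
INFINITE set `S` (e.g. a non-trivial interval), then `P₁Q₂ = P₂Q₁` as polynomials (stated in
`ℂ[X]`; a polynomial with infinitely many roots vanishes). [folklore] -/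
theorem unique {P₁ P₂ : K[X]} {Q₁ Q₂ : ℚ[X]} (hS : S.Infinite)
    (h₁ : ∀ x ∈ S, aeval (x : ℂ) Q₁ ≠ 0 ∧ φ x = aeval (x : ℂ) P₁ / aeval (x : ℂ) Q₁)
    (h₂ : ∀ x ∈ S, aeval (x : ℂ) Q₂ ≠ 0 ∧ φ x = aeval (x : ℂ) P₂ / aeval (x : ℂ) Q₂) :
    P₁.map (algebraMap K ℂ) * Q₂.map (algebraMap ℚ ℂ) =
      P₂.map (algebraMap K ℂ) * Q₁.map (algebraMap ℚ ℂ) := by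
  rw [← sub_eq_zero]
  apply Polynomial.eq_zero_of_infinite_isRoot
  refine (hS.image Complex.ofReal_injective.injOn).mono ?_
  rintro _ ⟨x, hx, rfl⟩
  obtain ⟨hQ₁, e₁⟩ := h₁ x hx
  obtain ⟨hQ₂, e₂⟩ := h₂ x hx
  have key : aeval (x : ℂ) P₁ * aeval (x : ℂ) Q₂ = aeval (x : ℂ) P₂ * aeval (x : ℂ) Q₁ := by
    rw [← div_eq_div_iff hQ₁ hQ₂, ← e₁, ← e₂]
  simp only [Set.mem_setOf_eq, IsRoot.def, eval_sub, eval_mul, eval_map_algebraMap, key,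
    sub_self]

/-- Uniqueness for `K = ℚ`, inside `ℚ[X]`: `P₁Q₂ = P₂Q₁`. [folklore] -/
theorem unique_rat {P₁ P₂ Q₁ Q₂ : ℚ[X]} (hS : S.Infinite)
    (h₁ : ∀ x ∈ S, aeval (x : ℂ) Q₁ ≠ 0 ∧ φ x = aeval (x : ℂ) P₁ / aeval (x : ℂ) Q₁)
    (h₂ : ∀ x ∈ S, aeval (x : ℂ) Q₂ ≠ 0 ∧ φ x = aeval (x : ℂ) P₂ / aeval (x : ℂ) Q₂) :
    P₁ * Q₂ = P₂ * Q₁ := by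
  apply Polynomial.map_injective _ (algebraMap ℚ ℂ).injective
  simpa only [Polynomial.map_mul] using unique hS h₁ h₂

/-- **Gluing.** Two representations of `φ` on `S` and on `T` with infinite overlap `S ∩ T` glue to
ONE fraction with rational denominator on `S ∪ T`: by uniqueness `P₁/Q₁ = P₂/Q₂ =: R`; with Bézout
in `ℚ[X]`, `G := gcd(Q₁,Q₂) = UQ₁ + VQ₂`, one has `R = (UP₁ + VP₂)/G`, and `G ∈ ℚ[X]` vanishes
only where both `Q₁` and `Q₂` do. [folklore] -/
theorem union (hS : IsRationalOn K φ S) (hT : IsRationalOn K φ T) (hST : (S ∩ T).Infinite) :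
    IsRationalOn K φ (S ∪ T) := by
  haveI : CharZero K := (algebraMap K ℂ).charZero
  obtain ⟨P₁, Q₁, h₁⟩ := hS
  obtain ⟨P₂, Q₂, h₂⟩ := hT
  have hmapQ : ∀ Q : ℚ[X], (Q.map (algebraMap ℚ K)).map (algebraMap K ℂ) =
      Q.map (algebraMap ℚ ℂ) := fun Q => by
    rw [Polynomial.map_map,
      Subsingleton.elim ((algebraMap K ℂ).comp (algebraMap ℚ K)) (algebraMap ℚ ℂ)]
  have huniq : P₁ * Q₂.map (algebraMap ℚ K) = P₂ * Q₁.map (algebraMap ℚ K) := by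
    apply Polynomial.map_injective _ (algebraMap K ℂ).injective
    simpa only [Polynomial.map_mul, hmapQ] using
      unique hST (fun x hx => h₁ x hx.1) (fun x hx => h₂ x hx.2)
  set G := EuclideanDomain.gcd Q₁ Q₂ with hG
  set U := EuclideanDomain.gcdA Q₁ Q₂ with hU
  set V := EuclideanDomain.gcdB Q₁ Q₂ with hV
  have hBez : G = Q₁ * U + Q₂ * V := EuclideanDomain.gcd_eq_gcd_ab Q₁ Q₂
  refine ⟨P₁ * U.map (algebraMap ℚ K) + P₂ * V.map (algebraMap ℚ K), G, ?_⟩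
  have id₁ : (P₁ * U.map (algebraMap ℚ K) + P₂ * V.map (algebraMap ℚ K)) *
      Q₁.map (algebraMap ℚ K) = P₁ * G.map (algebraMap ℚ K) := by
    rw [hBez, Polynomial.map_add, Polynomial.map_mul, Polynomial.map_mul]
    linear_combination (V.map (algebraMap ℚ K)) * huniq.symm
  have id₂ : (P₁ * U.map (algebraMap ℚ K) + P₂ * V.map (algebraMap ℚ K)) *
      Q₂.map (algebraMap ℚ K) = P₂ * G.map (algebraMap ℚ K) := by
    rw [hBez, Polynomial.map_add, Polynomial.map_mul, Polynomial.map_mul]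
    linear_combination (U.map (algebraMap ℚ K)) * huniq
  rintro x (hx | hx)
  · obtain ⟨hQ₁, e₁⟩ := h₁ x hx
    have hGx : aeval (x : ℂ) G ≠ 0 := fun h0 =>
      hQ₁ (aeval_eq_zero_of_dvd_aeval_eq_zero (EuclideanDomain.gcd_dvd_left Q₁ Q₂) h0)
    refine ⟨hGx, ?_⟩
    rw [e₁, div_eq_div_iff hQ₁ hGx]
    have := congrArg (aeval (x : ℂ)) id₁
    simp only [map_mul, map_add, aeval_map_algebraMap_rat] at this ⊢
    linear_combination -this
  · obtain ⟨hQ₂, e₂⟩ := h₂ x hx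
    have hGx : aeval (x : ℂ) G ≠ 0 := fun h0 =>
      hQ₂ (aeval_eq_zero_of_dvd_aeval_eq_zero (EuclideanDomain.gcd_dvd_right Q₁ Q₂) h0)
    refine ⟨hGx, ?_⟩
    rw [e₂, div_eq_div_iff hQ₂ hGx]
    have := congrArg (aeval (x : ℂ)) id₂
    simp only [map_mul, map_add, aeval_map_algebraMap_rat] at this ⊢
    linear_combination -this

/-- An affine function `ct + d` without zero on an order-connected set `S ⊆ ℝ` has constant sign
there (intermediate value theorem). [folklore] -/
theorem sign_cases {c d : ℝ} (hS : S.OrdConnected) (h0 : ∀ t ∈ S, c * t + d ≠ 0) :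
    (∀ t ∈ S, 0 < c * t + d) ∨ (∀ t ∈ S, c * t + d < 0) := by
  by_contra h
  push Not at h
  obtain ⟨⟨t₁, ht₁, h₁⟩, ⟨t₂, ht₂, h₂⟩⟩ := h
  have hcont : ContinuousOn (fun t : ℝ => c * t + d) (uIcc t₁ t₂) := by fun_prop
  have hmem : (0 : ℝ) ∈ uIcc (c * t₁ + d) (c * t₂ + d) := Set.mem_uIcc.2 (Or.inl ⟨h₁, h₂⟩)
  obtain ⟨t, ht, ht0⟩ := intermediate_value_uIcc hcont hmem
  exact h0 t (hS.uIcc_subset ht₁ ht₂ ht) ht0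

/-- A function represented by a fraction on a neighbourhood of `x` is real-analytic at `x`
(as a map `ℝ → ℂ`). [folklore] -/
theorem analyticAt {x : ℝ} (h : IsRationalOn K φ S) (hS : S ∈ 𝓝 x) : AnalyticAt ℝ φ x := by
  obtain ⟨P, Q, hPQ⟩ := h
  have hx : x ∈ S := mem_of_mem_nhds hS
  have hPa : AnalyticAt ℝ (fun t : ℝ => aeval (t : ℂ) P) x :=
    (Complex.ofRealCLM.analyticAt x).aeval_polynomial P
  have hQa : AnalyticAt ℝ (fun t : ℝ => aeval (t : ℂ) Q) x :=
    (Complex.ofRealCLM.analyticAt x).aeval_polynomial Q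
  refine (hPa.div hQa (hPQ x hx).1).congr ?_
  filter_upwards [hS] with t ht
  exact ((hPQ t ht).2).symm

end IsRationalOn

/-! ## 2. `PR_K`: structure theorem, module structure, analyticity -/

namespace IsPiecewiseRational

variable {φ ψ : ℝ → ℂ}

/-- **Structure theorem, hard direction.** If `φ` is `K`-piecewise rational with breakpoints `F`,
then `φ` is ONE fraction on EVERY order-connected (= convex) set `S ⊆ ℝ` containing no
breakpoint — bounded or not, with rational end points or not. (The definition only provides
bounded rational intervals and two tails; one-sided unbounded pieces are obtained by gluing,
`IsRationalOn.union`.) [folklore] -/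
theorem exists_forall_ordConnected (h : IsPiecewiseRational K φ) :
    ∃ F : Finset ℚ, ∀ S : Set ℝ, S.OrdConnected → (∀ r ∈ F, (r : ℝ) ∉ S) →
      IsRationalOn K φ S := by
  obtain ⟨F, hbdd, B, hup, hlow⟩ := h
  have hI : ∀ a b : ℚ, a < b → (∀ r ∈ F, r ≤ a ∨ b ≤ r) → IsRationalOn K φ (Ioo (a : ℝ) b) :=
    fun a b hab hF => by
      obtain ⟨P, Q, hPQ⟩ := hbdd a b hab hF
      exact ⟨P, Q, fun x hx => hPQ x hx.1 hx.2⟩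
  have hU : IsRationalOn K φ (Ioi (B : ℝ)) := by
    obtain ⟨P, Q, hPQ⟩ := hup
    exact ⟨P, Q, fun x hx => hPQ x hx⟩
  have hL : IsRationalOn K φ (Iio (-(B : ℝ))) := by
    obtain ⟨P, Q, hPQ⟩ := hlow
    exact ⟨P, Q, fun x hx => hPQ x hx⟩
  -- (H⁺): one-sided unbounded intervals to the right of `F`
  have Hplus : ∀ a : ℚ, (∀ r ∈ F, r ≤ a) → IsRationalOn K φ (Ioi (a : ℝ)) := by
    intro a ha
    have hlt : a < max a B + 1 := by linarith [le_max_left a B]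
    have h1 := hI a (max a B + 1) hlt (fun r hr => Or.inl (ha r hr))
    have h2 := h1.union hU ?_
    · refine h2.mono ?_
      intro x hx
      by_cases hxB : (B : ℝ) < x
      · exact Or.inr hxB
      · refine Or.inl ⟨hx, ?_⟩
        push Not at hxB
        push_cast
        linarith [le_max_right (a : ℝ) B]
    · refine (Set.Ioo_infinite (a := max (a : ℝ) B) (b := max (a : ℝ) B + 1) (by linarith)).mono ?_
      intro x hx
      refine ⟨⟨?_, ?_⟩, ?_⟩
      · exact lt_of_le_of_lt (le_max_left _ _) hx.1
      · push_cast; exact hx.2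
      · exact lt_of_le_of_lt (le_max_right _ _) hx.1
  -- (H⁻): one-sided unbounded intervals to the left of `F`
  have Hminus : ∀ b : ℚ, (∀ r ∈ F, b ≤ r) → IsRationalOn K φ (Iio (b : ℝ)) := by
    intro b hb
    have hlt : min b (-B) - 1 < b := by linarith [min_le_left b (-B)]
    have h1 := hI (min b (-B) - 1) b hlt (fun r hr => Or.inr (hb r hr))
    have h2 := h1.union hL ?_
    · refine h2.mono ?_
      intro x hx
      by_cases hxB : x < -(B : ℝ)
      · exact Or.inr hxB
      · refine Or.inl ⟨?_, hx⟩
        push Not at hxB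
        push_cast
        linarith [min_le_right (b : ℝ) (-B)]
    · refine (Set.Ioo_infinite (a := min (b : ℝ) (-B) - 1) (b := min (b : ℝ) (-B))
        (by linarith)).mono ?_
      intro x hx
      refine ⟨⟨?_, ?_⟩, ?_⟩
      · push_cast; exact hx.1
      · exact lt_of_lt_of_le hx.2 (min_le_left _ _)
      · exact lt_of_lt_of_le hx.2 (min_le_right _ _)
  refine ⟨F, fun S hS hFS => ?_⟩
  rcases S.eq_empty_or_nonempty with rfl | ⟨x, hx⟩
  · exact ⟨0, 1, fun x hx => (Set.notMem_empty x hx).elim⟩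
  set Fl := F.filter (fun r : ℚ => (r : ℝ) < x) with hFl
  set Fu := F.filter (fun r : ℚ => x < (r : ℝ)) with hFu
  have hFlu : ∀ r ∈ F, r ∈ Fl ∨ r ∈ Fu := by
    intro r hr
    rcases lt_trichotomy (r : ℝ) x with h | h | h
    · exact Or.inl (Finset.mem_filter.2 ⟨hr, h⟩)
    · exact (hFS r hr (h ▸ hx)).elim
    · exact Or.inr (Finset.mem_filter.2 ⟨hr, h⟩)
  have hlowS : ∀ hl : Fl.Nonempty, ∀ y ∈ S, ((Fl.max' hl : ℚ) : ℝ) < y := by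
    intro hl y hy
    by_contra hcon
    push Not at hcon
    have hm : Fl.max' hl ∈ Fl := Finset.max'_mem _ _
    have hmx : ((Fl.max' hl : ℚ) : ℝ) < x := (Finset.mem_filter.1 hm).2
    exact hFS _ (Finset.mem_filter.1 hm).1 (hS.out hy hx ⟨hcon, hmx.le⟩)
  have huppS : ∀ hu : Fu.Nonempty, ∀ y ∈ S, y < ((Fu.min' hu : ℚ) : ℝ) := by
    intro hu y hy
    by_contra hcon
    push Not at hcon
    have hm : Fu.min' hu ∈ Fu := Finset.min'_mem _ _
    have hmx : x < ((Fu.min' hu : ℚ) : ℝ) := (Finset.mem_filter.1 hm).2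
    exact hFS _ (Finset.mem_filter.1 hm).1 (hS.out hx hy ⟨hmx.le, hcon⟩)
  by_cases hl : Fl.Nonempty <;> by_cases hu : Fu.Nonempty
  · have hab : Fl.max' hl < Fu.min' hu := by
      have m1 : Fl.max' hl ∈ Fl := Finset.max'_mem _ _
      have m2 : Fu.min' hu ∈ Fu := Finset.min'_mem _ _
      have e1 : ((Fl.max' hl : ℚ) : ℝ) < x := (Finset.mem_filter.1 m1).2
      have e2 : x < ((Fu.min' hu : ℚ) : ℝ) := (Finset.mem_filter.1 m2).2
      exact_mod_cast e1.trans e2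
    refine (hI _ _ hab ?_).mono fun y hy => ⟨hlowS hl y hy, huppS hu y hy⟩
    intro r hr
    rcases hFlu r hr with h | h
    · exact Or.inl (Finset.le_max' _ _ h)
    · exact Or.inr (Finset.min'_le _ _ h)
  · refine (Hplus (Fl.max' hl) ?_).mono fun y hy => hlowS hl y hy
    intro r hr
    rcases hFlu r hr with h | h
    · exact Finset.le_max' _ _ h
    · exact (hu ⟨r, h⟩).elim
  · refine (Hminus (Fu.min' hu) ?_).mono fun y hy => huppS hu y hy
    intro r hr
    rcases hFlu r hr with h | h
    · exact (hl ⟨r, h⟩).elim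
    · exact Finset.min'_le _ _ h
  · have hF0 : ∀ r ∈ F, False := fun r hr => by
      rcases hFlu r hr with h | h
      exacts [hl ⟨r, h⟩, hu ⟨r, h⟩]
    have h1 := Hplus (-1) (fun r hr => (hF0 r hr).elim)
    have h2 := Hminus 1 (fun r hr => (hF0 r hr).elim)
    have h3 := h1.union h2 ((Set.Ioo_infinite (show (-1 : ℝ) < 1 by norm_num)).mono ?_)
    · refine h3.mono fun y _ => ?_
      simp only [Set.mem_union, Set.mem_Ioi, Set.mem_Iio, Rat.cast_neg, Rat.cast_one]
      by_cases hy : (-1 : ℝ) < y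
      · exact Or.inl hy
      · exact Or.inr (by linarith)
    · intro y hy
      refine ⟨?_, ?_⟩
      · push_cast; exact hy.1
      · push_cast; exact hy.2

/-- **Structure theorem, easy direction.** A finite set `F ⊂ ℚ` such that `φ` is one fraction on
every order-connected set avoiding `F` is a set of breakpoints for `φ` (tails: `|r| ≤ B` for
`r ∈ F`). This is the convenient way to PROVE `IsPiecewiseRational`. [folklore] -/
theorem of_forall_ordConnected (F : Finset ℚ)
    (h : ∀ S : Set ℝ, S.OrdConnected → (∀ r ∈ F, (r : ℝ) ∉ S) → IsRationalOn K φ S) :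
    IsPiecewiseRational K φ := by
  obtain ⟨M, hM⟩ := (F.image fun r => |r|).exists_le
  have hM' : ∀ r ∈ F, |r| ≤ M := fun r hr => hM _ (Finset.mem_image_of_mem _ hr)
  refine ⟨F, ?_, M, ?_, ?_⟩
  · intro a b hab hF
    have havoid : ∀ r ∈ F, (r : ℝ) ∉ Ioo (a : ℝ) b := by
      intro r hr hr'
      rcases hF r hr with h | h
      · exact absurd hr'.1 (not_lt.2 (by exact_mod_cast h))
      · exact absurd hr'.2 (not_lt.2 (by exact_mod_cast h))
    obtain ⟨P, Q, hPQ⟩ := h _ Set.ordConnected_Ioo havoid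
    exact ⟨P, Q, fun x hax hxb => hPQ x ⟨hax, hxb⟩⟩
  · have havoid : ∀ r ∈ F, (r : ℝ) ∉ Ioi (M : ℝ) := by
      intro r hr hr'
      have : (r : ℝ) ≤ M := by exact_mod_cast (le_abs_self r).trans (hM' r hr)
      exact absurd hr' (not_lt.2 this)
    obtain ⟨P, Q, hPQ⟩ := h _ Set.ordConnected_Ioi havoid
    exact ⟨P, Q, fun x hx => hPQ x hx⟩
  · have havoid : ∀ r ∈ F, (r : ℝ) ∉ Iio (-(M : ℝ)) := by
      intro r hr hr'
      have : -(M : ℝ) ≤ r := by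
        have := (neg_le.2 <| (neg_le_abs r).trans (hM' r hr))
        exact_mod_cast this
      exact absurd hr' (not_lt.2 this)
    obtain ⟨P, Q, hPQ⟩ := h _ Set.ordConnected_Iio havoid
    exact ⟨P, Q, fun x hx => hPQ x hx⟩

/-- **Structure theorem.** `φ ∈ PR_K` iff there is a finite `F ⊂ ℚ` such that `φ` is one fraction
(`K`-numerator, rational non-vanishing denominator) on every order-connected subset of `ℝ`
avoiding `F` — equivalently, on each connected component of `ℝ ∖ F`. [folklore] -/
theorem iff_forall_ordConnected :
    IsPiecewiseRational K φ ↔ ∃ F : Finset ℚ, ∀ S : Set ℝ, S.OrdConnected →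
      (∀ r ∈ F, (r : ℝ) ∉ S) → IsRationalOn K φ S :=
  ⟨exists_forall_ordConnected, fun ⟨F, hF⟩ => of_forall_ordConnected F hF⟩

/-- `0 ∈ PR_K`. [folklore] -/
theorem zero : IsPiecewiseRational K (0 : ℝ → ℂ) :=
  of_forall_ordConnected ∅ fun _ _ _ => IsRationalOn.zero

/-- `PR_K` is closed under addition (breakpoints: the union). [folklore] -/
theorem add (hφ : IsPiecewiseRational K φ) (hψ : IsPiecewiseRational K ψ) :
    IsPiecewiseRational K (φ + ψ) := by
  classical
  obtain ⟨F₁, h₁⟩ := hφ.exists_forall_ordConnected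
  obtain ⟨F₂, h₂⟩ := hψ.exists_forall_ordConnected
  refine of_forall_ordConnected (F₁ ∪ F₂) fun S hS hF => ?_
  exact (h₁ S hS fun r hr => hF r (Finset.mem_union_left _ hr)).add
    (h₂ S hS fun r hr => hF r (Finset.mem_union_right _ hr))

/-- `PR_K` is closed under scalars from `K`. [folklore] -/
theorem smul (k : K) (hφ : IsPiecewiseRational K φ) : IsPiecewiseRational K (k • φ) := by
  obtain ⟨F, h⟩ := hφ.exists_forall_ordConnected
  exact of_forall_ordConnected F fun S hS hF => (h S hS hF).smul k

/-- `PR_K` is closed under negation. [folklore] -/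
theorem neg (hφ : IsPiecewiseRational K φ) : IsPiecewiseRational K (-φ) := by
  obtain ⟨F, h⟩ := hφ.exists_forall_ordConnected
  exact of_forall_ordConnected F fun S hS hF => (h S hS hF).neg

/-- `PR_K` is closed under subtraction. [folklore] -/
theorem sub (hφ : IsPiecewiseRational K φ) (hψ : IsPiecewiseRational K ψ) :
    IsPiecewiseRational K (φ - ψ) := by
  rw [sub_eq_add_neg]; exact hφ.add hψ.neg

/-- `PR_K` is closed under pointwise products (it is a `K`-algebra of functions). [folklore] -/
theorem mul (hφ : IsPiecewiseRational K φ) (hψ : IsPiecewiseRational K ψ) :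
    IsPiecewiseRational K (φ * ψ) := by
  classical
  obtain ⟨F₁, h₁⟩ := hφ.exists_forall_ordConnected
  obtain ⟨F₂, h₂⟩ := hψ.exists_forall_ordConnected
  refine of_forall_ordConnected (F₁ ∪ F₂) fun S hS hF => ?_
  exact (h₁ S hS fun r hr => hF r (Finset.mem_union_left _ hr)).mul
    (h₂ S hS fun r hr => hF r (Finset.mem_union_right _ hr))

/-- Base change `PR_ℚ ⊆ PR_K`. [folklore] -/
theorem of_rat (hφ : IsPiecewiseRational ℚ φ) : IsPiecewiseRational K φ := by
  obtain ⟨F, h⟩ := hφ.exists_forall_ordConnected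
  exact of_forall_ordConnected F fun S hS hF => (h S hS hF).of_rat

/-- Base change `PR_K ⊆ PR_ℂ`. [folklore] -/
theorem to_complex (hφ : IsPiecewiseRational K φ) : IsPiecewiseRational ℂ φ := by
  obtain ⟨F, h⟩ := hφ.exists_forall_ordConnected
  exact of_forall_ordConnected F fun S hS hF => (h S hS hF).to_complex

/-- Changing `φ` at finitely many RATIONAL points keeps it piecewise rational (the points become
breakpoints). [folklore] -/
theorem congr_off_finset (G : Finset ℚ) (hφ : IsPiecewiseRational K φ)
    (hφψ : ∀ x : ℝ, (∀ r ∈ G, (r : ℝ) ≠ x) → φ x = ψ x) : IsPiecewiseRational K ψ := by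
  classical
  obtain ⟨F, h⟩ := hφ.exists_forall_ordConnected
  refine of_forall_ordConnected (F ∪ G) fun S hS hF => ?_
  refine (h S hS fun r hr => hF r (Finset.mem_union_left _ hr)).congr fun x hx => ?_
  exact hφψ x fun r hr hrx => hF r (Finset.mem_union_right _ hr) (hrx ▸ hx)

/-- Gluing two piecewise-rational functions at a rational point `r`: `φ` on `(-∞, r)`, `ψ` on
`[r, ∞)`. [folklore] -/
theorem piecewise_Iio (r : ℚ) (hφ : IsPiecewiseRational K φ) (hψ : IsPiecewiseRational K ψ) :
    IsPiecewiseRational K ((Set.Iio (r : ℝ)).piecewise φ ψ) := by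
  classical
  obtain ⟨F₁, h₁⟩ := hφ.exists_forall_ordConnected
  obtain ⟨F₂, h₂⟩ := hψ.exists_forall_ordConnected
  refine of_forall_ordConnected (insert r (F₁ ∪ F₂)) fun S hS hF => ?_
  have hr : (r : ℝ) ∉ S := hF r (Finset.mem_insert_self _ _)
  have hF₁ : ∀ s ∈ F₁, (s : ℝ) ∉ S := fun s hs =>
    hF s (Finset.mem_insert_of_mem (Finset.mem_union_left _ hs))
  have hF₂ : ∀ s ∈ F₂, (s : ℝ) ∉ S := fun s hs =>
    hF s (Finset.mem_insert_of_mem (Finset.mem_union_right _ hs))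
  by_cases hcase : ∃ y ∈ S, y < (r : ℝ)
  · obtain ⟨y, hy, hyr⟩ := hcase
    have hsub : S ⊆ Set.Iio (r : ℝ) := by
      intro z hz
      by_contra hzr
      exact hr (hS.out hy hz ⟨hyr.le, not_lt.1 hzr⟩)
    exact (h₁ S hS hF₁).congr fun x hx => (Set.piecewise_eq_of_mem _ _ _ (hsub hx)).symm
  · push Not at hcase
    refine (h₂ S hS hF₂).congr fun x hx => (Set.piecewise_eq_of_notMem _ _ _ ?_).symm
    exact fun hxr => absurd hxr (not_lt.2 (hcase x hx))

/-- **Semi-analyticity.** A piecewise-rational function is real-analytic (as a map `ℝ → ℂ`) at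
every real point which is not one of its finitely many rational breakpoints. [folklore] -/
theorem analyticAt (h : IsPiecewiseRational K φ) :
    ∃ F : Finset ℚ, ∀ x : ℝ, (∀ r ∈ F, (r : ℝ) ≠ x) → AnalyticAt ℝ φ x := by
  classical
  obtain ⟨F, hF⟩ := h.exists_forall_ordConnected
  refine ⟨F, fun x hx => ?_⟩
  have hopen : IsOpen ((↑(F.image (fun r : ℚ => (r : ℝ))) : Set ℝ)ᶜ) :=
    (Finset.finite_toSet _).isClosed.isOpen_compl
  have hxU : x ∈ ((↑(F.image (fun r : ℚ => (r : ℝ))) : Set ℝ)ᶜ) := by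
    simp only [Finset.coe_image, Set.mem_compl_iff, Set.mem_image, Finset.mem_coe, not_exists,
      not_and]
    exact fun r hr => hx r hr
  obtain ⟨ε, hε, hball⟩ := Metric.isOpen_iff.1 hopen x hxU
  refine (hF (Metric.ball x ε) ?_ ?_).analyticAt (Metric.ball_mem_nhds x hε)
  · rw [Real.ball_eq_Ioo]; exact Set.ordConnected_Ioo
  · intro r hr hrb
    have := hball hrb
    simp only [Finset.coe_image, Set.mem_compl_iff, Set.mem_image, Finset.mem_coe, not_exists,
      not_and] at this
    exact this r hr rfl

/-- Semi-analyticity in the route's form `IsSemiAnalytic φ := ∃ F : Finset ℝ, AnalyticOnNhd ℝ φ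
(↑F)ᶜ` (`PR_K ⊆ V^{ω*}`-type vectors: real-analytic off a finite set). [folklore] -/
theorem semiAnalytic (h : IsPiecewiseRational K φ) :
    ∃ F : Finset ℝ, AnalyticOnNhd ℝ φ ((↑F : Set ℝ)ᶜ) := by
  classical
  obtain ⟨F, hF⟩ := h.analyticAt
  refine ⟨F.image (fun r : ℚ => (r : ℝ)), fun x hx => hF x fun r hr hrx => hx ?_⟩
  simp only [Finset.coe_image, Set.mem_image, Finset.mem_coe]
  exact ⟨r, hr, hrx⟩

end IsPiecewiseRational

/-- `PR_K` as a `K`-submodule of the `K`-module of all functions `ℝ → ℂ` (`K` acting through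
`K → ℂ`): the `K`-subspace of `K`-piecewise-rational functions. [folklore] -/
def piecewiseRational (K : Type*) [Field K] [Algebra K ℂ] : Submodule K (ℝ → ℂ) where
  carrier := {φ | IsPiecewiseRational K φ}
  zero_mem' := IsPiecewiseRational.zero
  add_mem' h₁ h₂ := IsPiecewiseRational.add h₁ h₂
  smul_mem' c _ h := IsPiecewiseRational.smul c h

/-- Membership in `piecewiseRational K` is `IsPiecewiseRational K`. [folklore] -/
theorem mem_piecewiseRational {φ : ℝ → ℂ} :
    φ ∈ piecewiseRational K ↔ IsPiecewiseRational K φ :=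
  Iff.rfl

/-- For `K = ℚ`, `IsPiecewiseRational ℚ φ` is, by `Iff.rfl`, the text of the predicate `IsPRQ φ`
inlined by `let` in the route file `Summits/Langlands/Langlands/Theses/RationalPeriodQuarter.lean`
(rational breakpoints, `P Q : ℚ[X]`). [folklore] -/
theorem isPiecewiseRational_rat_iff {φ : ℝ → ℂ} : IsPiecewiseRational ℚ φ ↔
    ∃ F : Finset ℚ, (∀ a b : ℚ, a < b → (∀ r ∈ F, r ≤ a ∨ b ≤ r) → ∃ P Q : Polynomial ℚ,
      ∀ x : ℝ, (a : ℝ) < x → x < b → Polynomial.aeval (x : ℂ) Q ≠ 0 ∧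
        φ x = Polynomial.aeval (x : ℂ) P / Polynomial.aeval (x : ℂ) Q) ∧
      ∃ B : ℚ, (∃ P Q : Polynomial ℚ, ∀ x : ℝ, (B : ℝ) < x → Polynomial.aeval (x : ℂ) Q ≠ 0 ∧
        φ x = Polynomial.aeval (x : ℂ) P / Polynomial.aeval (x : ℂ) Q) ∧
      (∃ P Q : Polynomial ℚ, ∀ x : ℝ, x < -(B : ℝ) → Polynomial.aeval (x : ℂ) Q ≠ 0 ∧
        φ x = Polynomial.aeval (x : ℂ) P / Polynomial.aeval (x : ℂ) Q) :=
  Iff.rfl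

/-- For `K = ℂ`, `IsPiecewiseRational ℂ φ` is the route's inlined predicate `IsPRC φ` verbatim
(complex numerators `P : ℂ[X]` evaluated by `Polynomial.eval`, rational denominators
`Q : ℚ[X]`); the only difference to the definition is `aeval (x : ℂ) P = eval (x : ℂ) P` for
`P : ℂ[X]`. [folklore] -/
theorem isPiecewiseRational_complex_iff {φ : ℝ → ℂ} : IsPiecewiseRational ℂ φ ↔
    ∃ F : Finset ℚ, (∀ a b : ℚ, a < b → (∀ r ∈ F, r ≤ a ∨ b ≤ r) →
      ∃ (P : Polynomial ℂ) (Q : Polynomial ℚ), ∀ x : ℝ, (a : ℝ) < x → x < b →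
        Polynomial.aeval (x : ℂ) Q ≠ 0 ∧
          φ x = Polynomial.eval (x : ℂ) P / Polynomial.aeval (x : ℂ) Q) ∧
      ∃ B : ℚ, (∃ (P : Polynomial ℂ) (Q : Polynomial ℚ), ∀ x : ℝ, (B : ℝ) < x →
        Polynomial.aeval (x : ℂ) Q ≠ 0 ∧
          φ x = Polynomial.eval (x : ℂ) P / Polynomial.aeval (x : ℂ) Q) ∧
      (∃ (P : Polynomial ℂ) (Q : Polynomial ℚ), ∀ x : ℝ, x < -(B : ℝ) →
        Polynomial.aeval (x : ℂ) Q ≠ 0 ∧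
          φ x = Polynomial.eval (x : ℂ) P / Polynomial.aeval (x : ℂ) Q) := by
  simp only [IsPiecewiseRational, coe_aeval_eq_eval]

/-! ## 3. The weight-one line-model action and the stability of `PR_K` -/

/-- The determinant-free weight-one line-model action of an integer matrix `g = (a b; c d)` on
functions on the line: `slashHalf g φ t = |ct + d|⁻¹ · φ((at + b)/(ct + d))`. For `g ∈ SL₂(ℝ)`
this is the line-model action `(φ|_{2s} g)(x) = |cx + d|^{-2s} φ(gx)` of the principal series
`V_s` at `2s = 1` (Bruggeman–Lewis–Zagier (2.1)); the route `RationalPeriodQuarter` uses the same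
formula for integer matrices of positive determinant (Hecke operators; no `det` factor), which is
why `g` is any `Matrix (Fin 2) (Fin 2) ℤ` here. Junk value: at the pole `t = -d/c` (if `c ≠ 0`)
Lean's conventions `x/0 = 0`, `|0|⁻¹ = 0` give `slashHalf g φ (-d/c) = 0`.
[cite: BruggemanLewisZagier2015, §2.1 eq. (2.1)] -/
def slashHalf (g : Matrix (Fin 2) (Fin 2) ℤ) (φ : ℝ → ℂ) : ℝ → ℂ := fun t =>
  ((|((g 1 0 : ℤ) : ℝ) * t + ((g 1 1 : ℤ) : ℝ)|⁻¹ : ℝ) : ℂ) *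
    φ ((((g 0 0 : ℤ) : ℝ) * t + ((g 0 1 : ℤ) : ℝ)) / (((g 1 0 : ℤ) : ℝ) * t + ((g 1 1 : ℤ) : ℝ)))

/-- `slashHalf g` is additive. [folklore] -/
theorem slashHalf_add (g : Matrix (Fin 2) (Fin 2) ℤ) (φ ψ : ℝ → ℂ) :
    slashHalf g (φ + ψ) = slashHalf g φ + slashHalf g ψ := by
  ext t; simp [slashHalf, mul_add]

/-- `slashHalf g` commutes with complex scalars. [folklore] -/
theorem slashHalf_smul (g : Matrix (Fin 2) (Fin 2) ℤ) (c : ℂ) (φ : ℝ → ℂ) :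
    slashHalf g (c • φ) = c • slashHalf g φ := by
  ext t; simp [slashHalf]; ring

/-- The identity matrix acts trivially. [folklore] -/
theorem slashHalf_one (φ : ℝ → ℂ) : slashHalf 1 φ = φ := by
  ext t; simp [slashHalf]

/-- **Cocycle law** (right action): `φ|(gh) (t) = ((φ|g)|h) (t)` at every `t` off the pole of `h`
(`c_h t + d_h ≠ 0`; at the pole the right-hand side is the junk value `0`). Uses
`|c_h t + d_h| · |c_g (ht) + d_g| = |c_{gh} t + d_{gh}|` and `g(h t) = (gh) t`. [folklore] -/
theorem slashHalf_mul_apply (g h : Matrix (Fin 2) (Fin 2) ℤ) (φ : ℝ → ℂ) {t : ℝ}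
    (ht : ((h 1 0 : ℤ) : ℝ) * t + ((h 1 1 : ℤ) : ℝ) ≠ 0) :
    slashHalf (g * h) φ t = slashHalf h (slashHalf g φ) t := by
  simp only [slashHalf, Matrix.mul_apply, Fin.sum_univ_two, Int.cast_add, Int.cast_mul]
  set A : ℝ := ((h 1 0 : ℤ) : ℝ) * t + ((h 1 1 : ℤ) : ℝ) with hA
  set y : ℝ := (((h 0 0 : ℤ) : ℝ) * t + ((h 0 1 : ℤ) : ℝ)) / A with hy
  set N : ℝ := (((g 1 0 : ℤ) : ℝ) * ((h 0 0 : ℤ) : ℝ) + ((g 1 1 : ℤ) : ℝ) * ((h 1 0 : ℤ) : ℝ)) * t +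
    (((g 1 0 : ℤ) : ℝ) * ((h 0 1 : ℤ) : ℝ) + ((g 1 1 : ℤ) : ℝ) * ((h 1 1 : ℤ) : ℝ)) with hN
  set M : ℝ := (((g 0 0 : ℤ) : ℝ) * ((h 0 0 : ℤ) : ℝ) + ((g 0 1 : ℤ) : ℝ) * ((h 1 0 : ℤ) : ℝ)) * t +
    (((g 0 0 : ℤ) : ℝ) * ((h 0 1 : ℤ) : ℝ) + ((g 0 1 : ℤ) : ℝ) * ((h 1 1 : ℤ) : ℝ)) with hM
  have e1 : ((g 1 0 : ℤ) : ℝ) * y + ((g 1 1 : ℤ) : ℝ) = N / A := by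
    rw [hy, hN, eq_div_iff ht]
    field_simp
    ring
  have e2 : ((g 0 0 : ℤ) : ℝ) * y + ((g 0 1 : ℤ) : ℝ) = M / A := by
    rw [hy, hM, eq_div_iff ht]
    field_simp
    ring
  rw [e1, e2, div_div_div_cancel_right₀ ht, abs_div, inv_div, ← mul_assoc]
  congr 1
  have hA' : ((|A| : ℝ) : ℂ) ≠ 0 := by exact_mod_cast (abs_ne_zero.2 ht)
  push_cast
  field_simp

namespace IsPiecewiseRational

variable {φ : ℝ → ℂ}

/-- **Stability of `PR_K` under the line-model action, in coordinates.** For integers `a b c d`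
with `ad - bc ≠ 0` and `φ ∈ PR_K`, the function `t ↦ |ct+d|⁻¹ φ((at+b)/(ct+d))` is in `PR_K`.
New breakpoints: `-d/c` and the preimages `(dr - b)/(-cr + a)` of the old ones; on an
order-connected set avoiding them `ct + d` has constant sign (`IsRationalOn.sign_cases`), the
Möbius image is order-connected and avoids the old breakpoints, and `|ct+d|⁻¹ · P(gt) · Q(gt)⁻¹`
is a product of fractions with rational denominators (`IsRationalOn.linFrac`, `.aeval_comp`,
`.inv`, `.mul`). [folklore] -/
theorem slash_aux (hφ : IsPiecewiseRational K φ) (a b c d : ℤ) (hdet : a * d - b * c ≠ 0) :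
    IsPiecewiseRational K (fun t : ℝ =>
      ((|(c : ℝ) * t + d|⁻¹ : ℝ) : ℂ) * φ (((a : ℝ) * t + b) / ((c : ℝ) * t + d))) := by
  classical
  obtain ⟨F, hF⟩ := hφ.exists_forall_ordConnected
  refine of_forall_ordConnected
    (insert (-(d : ℚ) / c) (F.image fun r => ((d : ℚ) * r - b) / (-(c : ℚ) * r + a)))
    fun S hS hGS => ?_
  have hc0 : ((-(d : ℚ) / c : ℚ) : ℝ) ∉ S := hGS _ (Finset.mem_insert_self _ _)
  have hpre : ∀ r ∈ F, ((((d : ℚ) * r - b) / (-(c : ℚ) * r + a) : ℚ) : ℝ) ∉ S := fun r hr =>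
    hGS _ (Finset.mem_insert_of_mem (Finset.mem_image_of_mem _ hr))
  have hdetR : (a : ℝ) * d - b * c ≠ 0 := by exact_mod_cast hdet
  -- 1. the denominator does not vanish on `S`
  have hden : ∀ t ∈ S, (c : ℝ) * t + d ≠ 0 := by
    intro t ht h0
    by_cases hc : (c : ℝ) = 0
    · apply hdetR
      have hd : (d : ℝ) = 0 := by simpa [hc] using h0
      rw [hc, hd]; ring
    · apply hc0
      convert ht using 1
      push_cast
      field_simp
      linarith
  -- 2. the Möbius map as a ℚ-fraction, and `|ct+d|⁻¹` (constant sign on `S`)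
  set u : ℝ → ℝ := fun t => ((a : ℝ) * t + b) / ((c : ℝ) * t + d) with hu_def
  have hu : IsRationalOn ℚ (fun t => ((u t : ℝ) : ℂ)) S := IsRationalOn.linFrac a b c d hden
  have habs : IsRationalOn ℚ (fun t => (((|(c : ℝ) * t + d|)⁻¹ : ℝ) : ℂ)) S := by
    rcases IsRationalOn.sign_cases hS hden with hpos | hneg
    · refine (IsRationalOn.linFrac 0 1 c d hden).congr fun t ht => ?_
      rw [Complex.ofReal_inj, abs_of_pos (hpos t ht)]
      simp only [Int.cast_zero, Int.cast_one, zero_mul, zero_add, one_div]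
    · refine (IsRationalOn.linFrac 0 (-1) c d hden).congr fun t ht => ?_
      rw [Complex.ofReal_inj, abs_of_neg (hneg t ht)]
      simp only [Int.cast_zero, Int.cast_neg, Int.cast_one, zero_mul, zero_add, inv_neg,
        neg_div, one_div]
  -- 3. the image `u '' S` is order-connected and avoids `F`
  have hcont : ContinuousOn u S := by
    apply ContinuousOn.div (by fun_prop) (by fun_prop) hden
  have hOC : (u '' S).OrdConnected := (hS.isPreconnected.image u hcont).ordConnected
  have havoid : ∀ r ∈ F, (r : ℝ) ∉ u '' S := by
    rintro r hr ⟨t, ht, htr⟩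
    apply hpre r hr
    convert ht using 1
    have hct := hden t ht
    simp only [hu_def] at htr
    rw [div_eq_iff hct] at htr
    have hne : (-(c : ℝ) * r + a) ≠ 0 := by
      intro h0
      apply hdetR
      linear_combination (d + c * t) * h0 - c * htr
    push_cast
    rw [div_eq_iff hne]
    linear_combination -htr
  -- 4. represent `φ` on the image and pull back
  obtain ⟨P, Q, hPQ⟩ := hF (u '' S) hOC havoid
  have hP : IsRationalOn K (fun t => aeval ((u t : ℝ) : ℂ) P) S := hu.aeval_comp P
  have hQ : IsRationalOn ℚ (fun t => aeval ((u t : ℝ) : ℂ) Q) S := hu.aeval_comp Q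
  have hQ0 : ∀ t ∈ S, aeval ((u t : ℝ) : ℂ) Q ≠ 0 := fun t ht => (hPQ (u t) ⟨t, ht, rfl⟩).1
  have hall : IsRationalOn K
      ((fun t => (((|(c : ℝ) * t + d|)⁻¹ : ℝ) : ℂ)) *
        ((fun t => aeval ((u t : ℝ) : ℂ) P) * (fun t => aeval ((u t : ℝ) : ℂ) Q)⁻¹)) S :=
    habs.of_rat.mul (hP.mul (hQ.inv hQ0).of_rat)
  refine hall.congr fun t ht => ?_
  simp only [Pi.mul_apply, Pi.inv_apply]
  rw [(hPQ (u t) ⟨t, ht, rfl⟩).2, div_eq_mul_inv]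

/-- **`PR_K` is stable under the weight-one line-model action of every integer matrix of non-zero
determinant** — in particular under `SL₂(ℤ)` and under the Hecke matrices `(1 b; 0 p)`,
`(p 0; 0 1)` (the route's "wanted API"). [folklore] -/
theorem slashHalf (hφ : IsPiecewiseRational K φ) {g : Matrix (Fin 2) (Fin 2) ℤ}
    (hg : g.det ≠ 0) : IsPiecewiseRational K (slashHalf g φ) := by
  rw [Matrix.det_fin_two] at hg
  exact hφ.slash_aux (g 0 0) (g 0 1) (g 1 0) (g 1 1) (by
    intro h; apply hg; linear_combination h)

/-- Stability of `PR_K` under `SL₂(ℤ)` (the route's `slashHalf γ`, `γ : SL(2,ℤ)`, is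
`slashHalf ↑γ`). [folklore] -/
theorem slashHalf_sl (hφ : IsPiecewiseRational K φ) (γ : Matrix.SpecialLinearGroup (Fin 2) ℤ) :
    IsPiecewiseRational K
      (Literature.NumberTheory.Automorphic.slashHalf (γ : Matrix (Fin 2) (Fin 2) ℤ) φ) :=
  hφ.slashHalf (by rw [γ.det_coe]; exact one_ne_zero)

end IsPiecewiseRational

end Literature.NumberTheory.Automorphic
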